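import Summits.HubbardSuperconductivity.HubbardSuperconductivity.Theorems.AnisotropyChordTransferFibre3L2SlopeSoundB

/-!
# Route `AnisotropyChord` / H0 rotor rung, LEVEL 2: the first-order (slope) evaluator `sdEnclose` for `RExpr` and its soundness

★ `sdEnclose prec iters XS e : Option SD` — structural recursion over the term with the node operations of `…L2SlopeArith`
(kernel-reducible; `none` iff a reciprocal of an interval containing `0` is requested), ★★ `sdEnclose_sound` — if every
variable's datum encloses the pair `(x i, z i)` with increments `(δ₂, δ₃)` then the computed datum encloses `(e(x), e(z))`
(Krawczyk–Neumaier inclusion algebra, Neumaier 1990 Thm. 2.3.8, by structural induction on `e`), ★ `sdEnclose_bounds` — the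
CENTRED RANGE BOUND `e(x) ∈ c + s₂·D₂ + s₃·D₃ + e` (first order in the width of the moving coordinates), and
`holdsHull_of_between` (a quantity bracketed by two enclosed terms).
Prover seat `hubbard-h0-rotor-p2` g6; helper for piece A = stmt-HubbardSuperconductivity-23918 of rung 19089
(`--supports`, helper class).  Nothing here proves superconductivity in the Hubbard model; generic helper lemmas serving ONE
conditional reduction (the GM₃ ∀L certificate, Level-2 row `N₁`); the rotor TARGET as originally worded stays FALSE (g15 verdict).
Mathlib + the tree only; no sorry.
-/

set_option linter.dupNamespace false
set_option autoImplicit false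

namespace Summit.HubbardSuperconductivity.HubbardSuperconductivity.Theorems.AnisotropyChord.Transfer.Fibre3.L2

open Literature.Analysis.ValidatedNumerics NonemptyInterval

/-! ## The slope evaluator -/

/-- ★ first-order (slope) evaluation of an `RExpr` on slope data per variable (`none` iff a reciprocal of an interval
containing `0` is requested, at the centre or on the range).  Kernel-reducible. -/
def sdEnclose (prec iters : ℕ) (XS : ℕ → SD) : RExpr → Option SD
  | .const q => some (SD.const q)
  | .var i => some (XS i)
  | .add e₁ e₂ => obind₂ (sdEnclose prec iters XS e₁) (sdEnclose prec iters XS e₂) fun A B => A.add prec B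
  | .sub e₁ e₂ => obind₂ (sdEnclose prec iters XS e₁) (sdEnclose prec iters XS e₂) fun A B => A.sub prec B
  | .mul e₁ e₂ => obind₂ (sdEnclose prec iters XS e₁) (sdEnclose prec iters XS e₂) fun A B => A.mul prec B
  | .neg e => (sdEnclose prec iters XS e).map SD.neg
  | .sq e => (sdEnclose prec iters XS e).map fun A => A.sq prec
  | .inv e => (sdEnclose prec iters XS e).bind fun A => A.inv? prec
  | .abs e => (sdEnclose prec iters XS e).map SD.abs
  | .sqrt e => (sdEnclose prec iters XS e).map fun A => A.sqrt prec iters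
  | .min e₁ e₂ => obind₂ (sdEnclose prec iters XS e₁) (sdEnclose prec iters XS e₂) SD.min
  | .max e₁ e₂ => obind₂ (sdEnclose prec iters XS e₁) (sdEnclose prec iters XS e₂) SD.max

/-- ★★ **SOUNDNESS OF THE SLOPE EVALUATOR** (Krawczyk–Neumaier inclusion algebra, Neumaier 1990 Thm. 2.3.8, here with
remainder): if every variable's datum encloses the pair `(x i, z i)` with increments `(δ₂, δ₃)`, then the datum computed for a
term encloses the pair of its values `(e(x), e(z))` — by structural induction, each case being the corresponding `SD.*_holds`. -/
theorem sdEnclose_sound {prec iters : ℕ} {XS : ℕ → SD} {x z : ℕ → ℝ} {δ2 δ3 : ℝ}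
    (hX : ∀ i, (XS i).Holds δ2 δ3 (x i) (z i)) :
    ∀ (e : RExpr) {S : SD}, sdEnclose prec iters XS e = some S → S.Holds δ2 δ3 (e.eval x) (e.eval z)
  | .const q, S, h => by
    simp only [sdEnclose, Option.some.injEq] at h
    subst h; exact SD.const_holds q
  | .var i, S, h => by
    simp only [sdEnclose, Option.some.injEq] at h
    subst h; exact hX i
  | .add e₁ e₂, S, h => by
    obtain ⟨A, B, hA, hB, rfl⟩ := obind₂_eq_some_iff.1 h
    exact SD.add_holds prec (sdEnclose_sound hX e₁ hA) (sdEnclose_sound hX e₂ hB)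
  | .sub e₁ e₂, S, h => by
    obtain ⟨A, B, hA, hB, rfl⟩ := obind₂_eq_some_iff.1 h
    exact SD.sub_holds prec (sdEnclose_sound hX e₁ hA) (sdEnclose_sound hX e₂ hB)
  | .mul e₁ e₂, S, h => by
    obtain ⟨A, B, hA, hB, rfl⟩ := obind₂_eq_some_iff.1 h
    exact SD.mul_holds prec (sdEnclose_sound hX e₁ hA) (sdEnclose_sound hX e₂ hB)
  | .neg e, S, h => by
    obtain ⟨A, hA, rfl⟩ := Option.map_eq_some_iff.1 h
    exact SD.neg_holds (sdEnclose_sound hX e hA)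
  | .sq e, S, h => by
    obtain ⟨A, hA, rfl⟩ := Option.map_eq_some_iff.1 h
    exact SD.sq_holds prec (sdEnclose_sound hX e hA)
  | .inv e, S, h => by
    obtain ⟨A, hA, h2⟩ := Option.bind_eq_some_iff.1 h
    exact SD.holdsInv prec (sdEnclose_sound hX e hA) h2
  | .abs e, S, h => by
    obtain ⟨A, hA, rfl⟩ := Option.map_eq_some_iff.1 h
    exact SD.holdsAbs (sdEnclose_sound hX e hA)
  | .sqrt e, S, h => by
    obtain ⟨A, hA, rfl⟩ := Option.map_eq_some_iff.1 h
    exact SD.holdsSqrt prec iters (sdEnclose_sound hX e hA)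
  | .min e₁ e₂, S, h => by
    obtain ⟨A, B, hA, hB, rfl⟩ := obind₂_eq_some_iff.1 h
    exact SD.holdsMin (sdEnclose_sound hX e₁ hA) (sdEnclose_sound hX e₂ hB)
  | .max e₁ e₂, S, h => by
    obtain ⟨A, B, hA, hB, rfl⟩ := obind₂_eq_some_iff.1 h
    exact SD.holdsMax (sdEnclose_sound hX e₁ hA) (sdEnclose_sound hX e₂ hB)

/-- ★ **THE CENTRED BOUND**: under the hypotheses of `sdEnclose_sound`, with the increments in `(D₂, D₃)`,
`lb ≤ e(x) ≤ ub` — the first-order range bound `e(x) ∈ c + s₂·D₂ + s₃·D₃ + e`. -/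
theorem sdEnclose_bounds {prec iters : ℕ} {XS : ℕ → SD} {x z : ℕ → ℝ} {δ2 δ3 : ℝ}
    (hX : ∀ i, (XS i).Holds δ2 δ3 (x i) (z i)) {D2 D3 : NonemptyInterval ℚ} (h2 : δ2 ∈ D2.ratCast ℝ)
    (h3 : δ3 ∈ D3.ratCast ℝ) (e : RExpr) {S : SD} (h : sdEnclose prec iters XS e = some S) :
    ((S.lb D2 D3 : ℚ) : ℝ) ≤ e.eval x ∧ e.eval x ≤ ((S.ub D2 D3 : ℚ) : ℝ) :=
  SD.holdsBounds (sdEnclose_sound hX e h) h2 h3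

/-- ★ a quantity bracketed by two enclosed terms at `x` is enclosed, together with a suitable centre value, by the hull of
their data (the bracketing need not hold at `z`). -/
theorem holdsHull_of_between {A B : SD} {δ2 δ3 fx fz gx gz v : ℝ} (hA : A.Holds δ2 δ3 fx fz)
    (hB : B.Holds δ2 δ3 gx gz) (h1 : fx ≤ v) (h2 : v ≤ gx) :
    ∃ w : ℝ, (A.hull B).Holds δ2 δ3 v w := by
  obtain ⟨θ, h0, h1', hv⟩ := exists_convex_of_between (u := fx) (v := gx) (w := v)
    (by rw [min_eq_left (h1.trans h2)]; exact h1) (by rw [max_eq_right (h1.trans h2)]; exact h2)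
  exact ⟨θ * fz + (1 - θ) * gz, hv ▸ SD.holdsHull hA hB h0 h1'⟩

end Summit.HubbardSuperconductivity.HubbardSuperconductivity.Theorems.AnisotropyChord.Transfer.Fibre3.L2
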